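import Mathlib
import HarnessLib
import Summits.NavierStokesRegularity.NavierStokesRegularity.Theorems.ChiralWindowDoorDefs
import Summits.NavierStokesRegularity.NavierStokesRegularity.Theorems.ChiralWindowDoorLambda
import Summits.NavierStokesRegularity.NavierStokesRegularity.Theorems.ChiralWindowDoorTruncatedSymmetrisation
import Summits.NavierStokesRegularity.NavierStokesRegularity.Theorems.ChiralWindowDoorFracLapHalfBounds

/-!
# Door S20 «ChiralWindowDoor» — THE GAGLIARDO–`Λ` IDENTITY `G(a,f) = ∫ a⟪f, Λf⟫ − ½∫‖f‖² Λa`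
# (B1′ of nsreg-p1's R19-LINE with the truncation REMOVED)

Door S20 of nsreg-p1's local Type-I door family (`HOME/ns-regularity-ideate-p1/r19/R19-LINE.md` §B1′; DESIGN-ONLY,
route NOT born).  For a non-negative `C²`-type weight `a` supported in a ball (`0 ≤ a ≤ A₀`, quadratic second
differences, `a = 0` off `B_ρ(0)`) and a bounded Lipschitz field `f` with quadratic second differences — exactly the
shape of a door-class slice and of the bump `bumpSq η R` — the substrate's weighted Gagliardo form
(`…ChiralWindowDoorDefs.gagliardo`, kernel `lamK = π⁻²‖z‖⁻⁴`) satisfies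

  `gagliardo a f = ∫ a(x) ⟪f x, Λ f x⟫ dx − ½ ∫ ‖f x‖² (Λ a)(x) dx`    (`Λ = fracLapHalf`, `Λ a = fracLapHalfS a`),

obtained from the truncated identity (`…TruncatedSymmetrisation.truncated_symmetrisation`, kernels `K_{1/(n+1)}`) by
three dominated-convergence limits (`…FracLapHalfBounds`): the Gagliardo side (dominated by its own `lamK` integrand,
integrable for Lipschitz `f`), the helicity side (uniform majorant × `|a|`), the weight side (uniform bound near,
`‖x‖⁻⁴` far-field decay of `Λ a` off `B_{2ρ}`).

* `exists_majorant_firstDiffSq`, `integrable_symG_lamK` — the full Gagliardo integrand is integrable;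
* `tendsto_integral_symG` , `tendsto_helicitySide`, `tendsto_weightSide` — the three limits;
* `gagliardo_eq_integral_sub` — **the identity**; `gagliardo_le_integral_add` — the B1′ SHAPE
  `G(a,f) ≤ ∫ a⟪f, Λf⟫ + ½∫‖f‖²|Λa|` with NO truncation left (for a chiral `f`, `Λ f = curl f` turns the first term
  into the localised helicity `locHelicity a f`).

Seat nsreg-p6 g11 (THEOREMS-ONLY door sequels, DIRECTOR-NS g8 #32 (2)/#36).  WHAT THIS IS NOT: not NS regularity
(Clay A); not yet B1′ for the door class (the scaling of `Λ(bumpSq η R)` and the decay bookkeeping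
`½∫‖v‖²|Λa_R| ≤ c(η)D²` are the remaining step); no route is opened.
-/

noncomputable section

-- the summit and its single sub-problem share the name (CONVENTIONS §1), as in every Theorems file
set_option linter.dupNamespace false

namespace Summit.NavierStokesRegularity.NavierStokesRegularity.Theorems.ChiralWindowDoorGagliardoIdentity

open MeasureTheory Set Filter Topology Metric
open scoped RealInnerProductSpace
open Summit.NavierStokesRegularity.NavierStokesRegularity.Theorems.ChiralWindowDoorDefs
open Summit.NavierStokesRegularity.NavierStokesRegularity.Theorems.ChiralWindowDoorLambda
open Summit.NavierStokesRegularity.NavierStokesRegularity.Theorems.ChiralWindowDoorTruncatedSymmetrisation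
open Summit.NavierStokesRegularity.NavierStokesRegularity.Theorems.ChiralWindowDoorFracLapHalfBounds

section Main

variable {a : EuclideanSpace ℝ (Fin 3) → ℝ} {f : EuclideanSpace ℝ (Fin 3) → EuclideanSpace ℝ (Fin 3)}
  {A₀ A₂ ρ M₀ M₁ M₂ : ℝ}

/-! ### The full Gagliardo integrand is integrable for a Lipschitz bounded field -/

/-- An even integrable majorant of `lamK(x−y) ‖f x − f y‖²` for a bounded Lipschitz field
(near the diagonal `π⁻²M₁²‖x−y‖⁻²`, far `4M₀² lamKTrunc ½`). -/
theorem exists_majorant_firstDiffSq (hf0 : ∀ x, ‖f x‖ ≤ M₀) (hf1 : ∀ x y, ‖f x - f y‖ ≤ M₁ * ‖x - y‖) :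
    ∃ g : EuclideanSpace ℝ (Fin 3) → ℝ, Integrable g ∧ (∀ w, g (-w) = g w) ∧
      ∀ x y, lamK (x - y) * ‖f x - f y‖ ^ 2 ≤ g (x - y) := by
  have hM₀ : 0 ≤ M₀ := (norm_nonneg _).trans (hf0 0)
  refine ⟨fun w => (ball (0 : EuclideanSpace ℝ (Fin 3)) 1).indicator
      (fun w => (1 / Real.pi ^ 2 * M₁ ^ 2) * ‖w‖ ^ (-(2 : ℝ))) w + 4 * M₀ ^ 2 * lamKTrunc (1 / 2) w, ?_, ?_, ?_⟩
  · refine Integrable.add ?_ ((integrable_lamKTrunc (by norm_num : (0 : ℝ) < 1 / 2)).const_mul _)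
    refine IntegrableOn.integrable_indicator ?_ measurableSet_ball
    have hmeas : Measurable fun w : EuclideanSpace ℝ (Fin 3) => (1 / Real.pi ^ 2 * M₁ ^ 2) * ‖w‖ ^ (-(2 : ℝ)) :=
      Measurable.const_mul (continuous_norm.measurable.pow_const _) _
    exact integrableOn_ball_of_norm_le_rpow (E := EuclideanSpace ℝ (Fin 3)) (F := ℝ) (μ := volume)
      (f := fun w => (1 / Real.pi ^ 2 * M₁ ^ 2) * ‖w‖ ^ (-(2 : ℝ)))
      (by rw [finrank_euclideanSpace_fin]; norm_num) (C := 1 / Real.pi ^ 2 * M₁ ^ 2) (α := 2) (r := 1)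
      (by rw [finrank_euclideanSpace_fin]; norm_num)
      (ae_of_all _ fun w => by rw [Real.norm_eq_abs, abs_of_nonneg (by positivity)])
      hmeas.aestronglyMeasurable
  · intro w
    dsimp only
    have hball : (-w ∈ ball (0 : EuclideanSpace ℝ (Fin 3)) 1) ↔ (w ∈ ball (0 : EuclideanSpace ℝ (Fin 3)) 1) := by
      simp [mem_ball, dist_zero_right, norm_neg]
    by_cases hw : w ∈ ball (0 : EuclideanSpace ℝ (Fin 3)) 1
    · rw [indicator_of_mem hw, indicator_of_mem (hball.2 hw), norm_neg, lamKTrunc_neg]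
    · rw [indicator_of_notMem hw, indicator_of_notMem (fun h => hw (hball.1 h)), lamKTrunc_neg]
  · intro x y
    dsimp only
    set w : EuclideanSpace ℝ (Fin 3) := x - y with hw_def
    have hdsq : ‖f x - f y‖ ^ 2 ≤ M₁ ^ 2 * ‖w‖ ^ 2 := by
      have h := hf1 x y
      have hM₁w : 0 ≤ M₁ * ‖x - y‖ := (norm_nonneg _).trans h
      calc ‖f x - f y‖ ^ 2 ≤ (M₁ * ‖x - y‖) ^ 2 := pow_le_pow_left₀ (norm_nonneg _) h 2
        _ = M₁ ^ 2 * ‖w‖ ^ 2 := by rw [hw_def]; ring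
    by_cases hw : w ∈ ball (0 : EuclideanSpace ℝ (Fin 3)) 1
    · rw [indicator_of_mem hw]
      have h1 : lamK w * ‖f x - f y‖ ^ 2 ≤ (1 / Real.pi ^ 2 * M₁ ^ 2) * ‖w‖ ^ (-(2 : ℝ)) :=
        (mul_le_mul_of_nonneg_left hdsq (lamK_nonneg w)).trans (lamK_mul_sq_le (sq_nonneg M₁) w)
      have h2 : 0 ≤ 4 * M₀ ^ 2 * lamKTrunc (1 / 2) w := by have := lamKTrunc_nonneg (1 / 2) w; positivity
      linarith
    · rw [indicator_of_notMem hw, zero_add]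
      have hw1 : 1 ≤ ‖w‖ := by simpa [mem_ball, dist_zero_right] using hw
      have hK : lamKTrunc (1 / 2) w = lamK w := lamKTrunc_of_lt (by linarith)
      have hD : ‖f x - f y‖ ^ 2 ≤ 4 * M₀ ^ 2 := by
        have : ‖f x - f y‖ ≤ 2 * M₀ := by
          calc ‖f x - f y‖ ≤ ‖f x‖ + ‖f y‖ := norm_sub_le _ _
            _ ≤ M₀ + M₀ := add_le_add (hf0 _) (hf0 _)
            _ = 2 * M₀ := by ring
        calc ‖f x - f y‖ ^ 2 ≤ (2 * M₀) ^ 2 := pow_le_pow_left₀ (norm_nonneg _) this 2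
          _ = 4 * M₀ ^ 2 := by ring
      calc lamK w * ‖f x - f y‖ ^ 2 ≤ lamK w * (4 * M₀ ^ 2) := mul_le_mul_of_nonneg_left hD (lamK_nonneg w)
        _ = 4 * M₀ ^ 2 * lamKTrunc (1 / 2) w := by rw [hK]; ring

/-- **The full Gagliardo integrand `symG a f lamK` is integrable on `ℝ³ × ℝ³`** for a non-negative continuous integrable
weight and a bounded Lipschitz continuous field. -/
theorem integrable_symG_lamK (hac : Continuous a) (hai : Integrable a) (hann : ∀ x, 0 ≤ a x)
    (hfc : Continuous f) (hf0 : ∀ x, ‖f x‖ ≤ M₀) (hf1 : ∀ x y, ‖f x - f y‖ ≤ M₁ * ‖x - y‖) :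
    Integrable (symG a f lamK) := by
  obtain ⟨g, hgi, hgev, hg⟩ := exists_majorant_firstDiffSq hf0 hf1
  have hdom : Integrable (fun p : EuclideanSpace ℝ (Fin 3) × EuclideanSpace ℝ (Fin 3) =>
      a p.1 * g (p.1 - p.2) + g (p.1 - p.2) * a p.2) :=
    (integrable_prod_kernel_left hai hgi hgev).add (integrable_prod_kernel_right hgi hai)
  have hmeas : AEStronglyMeasurable (symG a f lamK)
      (volume : Measure (EuclideanSpace ℝ (Fin 3) × EuclideanSpace ℝ (Fin 3))) := by
    have hm : Measurable (symG a f lamK) := by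
      unfold symG
      exact ((hac.measurable.comp measurable_fst).add (hac.measurable.comp measurable_snd)).mul
        ((measurable_lamK.comp (measurable_fst.sub measurable_snd)).mul
          (by fun_prop : Continuous fun p : EuclideanSpace ℝ (Fin 3) × EuclideanSpace ℝ (Fin 3) =>
            ‖f p.1 - f p.2‖ ^ 2).measurable)
    exact hm.aestronglyMeasurable
  refine hdom.mono' hmeas (ae_of_all _ fun p => ?_)
  have hnn : 0 ≤ symG a f lamK p := by
    unfold symG
    exact mul_nonneg (add_nonneg (hann _) (hann _)) (mul_nonneg (lamK_nonneg _) (by positivity))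
  rw [Real.norm_eq_abs, abs_of_nonneg hnn]
  unfold symG
  calc (a p.1 + a p.2) * (lamK (p.1 - p.2) * ‖f p.1 - f p.2‖ ^ 2) ≤ (a p.1 + a p.2) * g (p.1 - p.2) :=
        mul_le_mul_of_nonneg_left (hg p.1 p.2) (add_nonneg (hann _) (hann _))
    _ = a p.1 * g (p.1 - p.2) + g (p.1 - p.2) * a p.2 := by ring

/-! ### The three limits along `ε_n = 1/(n+1)` -/

/-- **Gagliardo side**: `∫ symG a f K_{1/(n+1)} → ∫ symG a f lamK` (dominated by the full integrand). -/
theorem tendsto_integral_symG (hac : Continuous a) (hai : Integrable a) (hann : ∀ x, 0 ≤ a x)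
    (hfc : Continuous f) (hf0 : ∀ x, ‖f x‖ ≤ M₀) (hf1 : ∀ x y, ‖f x - f y‖ ≤ M₁ * ‖x - y‖) :
    Tendsto (fun n : ℕ => ∫ p : EuclideanSpace ℝ (Fin 3) × EuclideanSpace ℝ (Fin 3),
        symG a f (lamKTrunc (1 / ((n : ℝ) + 1))) p)
      atTop (𝓝 (∫ p : EuclideanSpace ℝ (Fin 3) × EuclideanSpace ℝ (Fin 3), symG a f lamK p)) := by
  have hG := integrable_symG_lamK hac hai hann hfc hf0 hf1
  refine tendsto_integral_of_dominated_convergence (fun p => symG a f lamK p) (fun n => ?_) hG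
    (fun n => ae_of_all _ fun p => ?_) (ae_of_all _ fun p => ?_)
  · have hm : Measurable (symG a f (lamKTrunc (1 / ((n : ℝ) + 1)))) := by
      unfold symG
      exact ((hac.measurable.comp measurable_fst).add (hac.measurable.comp measurable_snd)).mul
        (((measurable_lamKTrunc _).comp (measurable_fst.sub measurable_snd)).mul
          (by fun_prop : Continuous fun p : EuclideanSpace ℝ (Fin 3) × EuclideanSpace ℝ (Fin 3) =>
            ‖f p.1 - f p.2‖ ^ 2).measurable)
    exact hm.aestronglyMeasurable
  · have hw : 0 ≤ a p.1 + a p.2 := add_nonneg (hann _) (hann _)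
    have hnn : 0 ≤ symG a f (lamKTrunc (1 / ((n : ℝ) + 1))) p := by
      unfold symG
      exact mul_nonneg hw (mul_nonneg (lamKTrunc_nonneg _ _) (by positivity))
    rw [Real.norm_eq_abs, abs_of_nonneg hnn]
    unfold symG
    exact mul_le_mul_of_nonneg_left
      (mul_le_mul_of_nonneg_right (lamKTrunc_le_lamK _ _) (by positivity)) hw
  · -- pointwise: eventually the truncation does not see `p.1 - p.2`
    unfold symG
    by_cases hp : p.1 - p.2 = 0
    · have h0 : ∀ n : ℕ, lamKTrunc (1 / ((n : ℝ) + 1)) (p.1 - p.2) = 0 := fun n => by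
        rw [hp]; exact lamKTrunc_of_le (by rw [norm_zero]; positivity)
      have h0' : lamK (p.1 - p.2) = 0 := by rw [hp]; exact lamK_zero
      simp only [h0, h0']
      exact tendsto_const_nhds
    · have hzpos : 0 < ‖p.1 - p.2‖ := norm_pos_iff.2 hp
      obtain ⟨N, hN⟩ := exists_nat_one_div_lt hzpos
      refine tendsto_const_nhds.congr' ?_
      filter_upwards [Filter.eventually_ge_atTop N] with n hn
      have hlt : 1 / ((n : ℝ) + 1) < ‖p.1 - p.2‖ := by
        refine lt_of_le_of_lt ?_ hN
        gcongr
      rw [lamKTrunc_of_lt hlt]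

/-- **Helicity side**: `∫ a(x)⟪f x, ½ L_n f x⟫ dx → ∫ a(x)⟪f x, Λ f x⟫ dx`. -/
theorem tendsto_helicitySide (hac : Continuous a) (hai : Integrable a)
    (hfc : Continuous f) (hf0 : ∀ x, ‖f x‖ ≤ M₀)
    (hf2 : ∀ x z, ‖(2 : ℝ) • f x - f (x + z) - f (x - z)‖ ≤ M₂ * ‖z‖ ^ 2) :
    Tendsto (fun n : ℕ => ∫ x, a x * ⟪f x, (1 / 2 : ℝ) •
        ∫ z, lamKTrunc (1 / ((n : ℝ) + 1)) z • ((2 : ℝ) • f x - f (x + z) - f (x - z))⟫)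
      atTop (𝓝 (∫ x, a x * ⟪f x, fracLapHalf f x⟫)) := by
  have hM₀ : 0 ≤ M₀ := (norm_nonneg _).trans (hf0 0)
  obtain ⟨g, hgi, hgnn, hg⟩ := exists_majorant_secondDiff hf0 hf2
  have hIg : 0 ≤ ∫ z, g z := integral_nonneg hgnn
  refine tendsto_integral_of_dominated_convergence (fun x => ‖a x‖ * (M₀ * ((1 / 2 : ℝ) * ∫ z, g z)))
    (fun n => ?_) (hai.norm.mul_const _) (fun n => ae_of_all _ fun x => ?_) (ae_of_all _ fun x => ?_)
  · set g : EuclideanSpace ℝ (Fin 3) → EuclideanSpace ℝ (Fin 3) := fun x =>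
      ∫ z, lamKTrunc (1 / ((n : ℝ) + 1)) z • ((2 : ℝ) • f x - f (x + z) - f (x - z)) with hg_def
    have hgc : Continuous g := continuous_secondDiffOp hfc hf0 hf2 _
    have hc : Continuous fun x => a x * ⟪f x, (1 / 2 : ℝ) • g x⟫ := by fun_prop
    exact hc.aestronglyMeasurable
  · rw [norm_mul]
    refine mul_le_mul_of_nonneg_left ?_ (norm_nonneg _)
    calc ‖⟪f x, (1 / 2 : ℝ) • ∫ z, lamKTrunc (1 / ((n : ℝ) + 1)) z • ((2 : ℝ) • f x - f (x + z) - f (x - z))⟫‖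
        ≤ ‖f x‖ * ‖(1 / 2 : ℝ) • ∫ z, lamKTrunc (1 / ((n : ℝ) + 1)) z • ((2 : ℝ) • f x - f (x + z) - f (x - z))‖ :=
          norm_inner_le_norm _ _
      _ ≤ M₀ * ((1 / 2 : ℝ) * ∫ z, g z) := by
          refine mul_le_mul (hf0 x) ?_ (norm_nonneg _) hM₀
          rw [norm_smul, Real.norm_eq_abs, abs_of_pos (by norm_num : (0 : ℝ) < 1 / 2)]
          exact mul_le_mul_of_nonneg_left (norm_secondDiffOp_le hgi hg _ x) (by norm_num)
  · have h := tendsto_secondDiffOp hfc hf0 hf2 x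
    have h2 : Tendsto (fun n : ℕ => (1 / 2 : ℝ) •
        ∫ z, lamKTrunc (1 / ((n : ℝ) + 1)) z • ((2 : ℝ) • f x - f (x + z) - f (x - z))) atTop
        (𝓝 (fracLapHalf f x)) := by
      unfold fracLapHalf
      exact h.const_smul _
    exact (tendsto_const_nhds.inner h2).const_mul (a x)

/-- **Weight side**: `∫ ‖f x‖² (½ L_n a)(x) dx → ∫ ‖f x‖² (Λ a)(x) dx` (uniform bound near, `‖x‖⁻⁴` far). -/
theorem tendsto_weightSide (hac : Continuous a) (hai : Integrable a) (ha0 : ∀ x, |a x| ≤ A₀)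
    (ha2 : ∀ x z, |2 * a x - a (x + z) - a (x - z)| ≤ A₂ * ‖z‖ ^ 2) (hρ : 0 < ρ)
    (hsupp : ∀ x, ρ ≤ ‖x‖ → a x = 0) (hfc : Continuous f) (hf0 : ∀ x, ‖f x‖ ≤ M₀) :
    Tendsto (fun n : ℕ => ∫ x, ‖f x‖ ^ 2 *
        ((1 / 2 : ℝ) * ∫ z, lamKTrunc (1 / ((n : ℝ) + 1)) z * (2 * a x - a (x + z) - a (x - z))))
      atTop (𝓝 (∫ x, ‖f x‖ ^ 2 * fracLapHalfS a x)) := by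
  have hM₀ : 0 ≤ M₀ := (norm_nonneg _).trans (hf0 0)
  obtain ⟨g, hgi, hgnn, hg⟩ := exists_majorant_secondDiff_real ha0 ha2
  have hIg : 0 ≤ ∫ z, g z := integral_nonneg hgnn
  set L1 : ℝ := ∫ y, |a y| with hL1
  have hL1nn : 0 ≤ L1 := integral_nonneg fun y => abs_nonneg _
  -- the dominating function
  set b : EuclideanSpace ℝ (Fin 3) → ℝ := fun x => M₀ ^ 2 * ((1 / 2 : ℝ) *
    ((ball (0 : EuclideanSpace ℝ (Fin 3)) (2 * ρ)).indicator (fun _ => ∫ z, g z) x +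
      32 * L1 * lamKTrunc ρ x)) with hb
  have hbi : Integrable b := by
    refine Integrable.const_mul (Integrable.const_mul (Integrable.add ?_ ((integrable_lamKTrunc hρ).const_mul _)) _) _
    exact IntegrableOn.integrable_indicator (integrableOn_const (measure_ball_lt_top.ne)) measurableSet_ball
  refine tendsto_integral_of_dominated_convergence b (fun n => ?_) hbi (fun n => ae_of_all _ fun x => ?_)
    (ae_of_all _ fun x => ?_)
  · set g : EuclideanSpace ℝ (Fin 3) → ℝ := fun x =>
      ∫ z, lamKTrunc (1 / ((n : ℝ) + 1)) z * (2 * a x - a (x + z) - a (x - z)) with hg_def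
    have hgc : Continuous g := continuous_secondDiffOp_real hac ha0 ha2 _
    have hc : Continuous fun x => ‖f x‖ ^ 2 * ((1 / 2 : ℝ) * g x) := by fun_prop
    exact hc.aestronglyMeasurable
  · -- the bound
    have hfx : ‖f x‖ ^ 2 ≤ M₀ ^ 2 := pow_le_pow_left₀ (norm_nonneg _) (hf0 x) 2
    have hLn : |∫ z, lamKTrunc (1 / ((n : ℝ) + 1)) z * (2 * a x - a (x + z) - a (x - z))| ≤
        (ball (0 : EuclideanSpace ℝ (Fin 3)) (2 * ρ)).indicator (fun _ => ∫ z, g z) x + 32 * L1 * lamKTrunc ρ x := by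
      by_cases hx : x ∈ ball (0 : EuclideanSpace ℝ (Fin 3)) (2 * ρ)
      · rw [indicator_of_mem hx]
        have h1 := abs_secondDiffOp_real_le hgi hg (1 / ((n : ℝ) + 1)) x
        have h2 : 0 ≤ 32 * L1 * lamKTrunc ρ x := by have := lamKTrunc_nonneg ρ x; positivity
        linarith
      · rw [indicator_of_notMem hx, zero_add]
        have hx' : 2 * ρ ≤ ‖x‖ := by simpa [mem_ball, dist_zero_right] using hx
        have h1 := abs_secondDiffOp_real_le_far hai hρ hsupp (1 / ((n : ℝ) + 1)) hx'
        rwa [← lamKTrunc_of_lt (show ρ < ‖x‖ by linarith)] at h1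
    rw [hb]
    dsimp only
    rw [norm_mul, norm_pow, norm_norm, norm_mul, Real.norm_eq_abs (1 / 2 : ℝ), abs_of_pos (by norm_num : (0 : ℝ) < 1 / 2),
      Real.norm_eq_abs]
    have hind : 0 ≤ (ball (0 : EuclideanSpace ℝ (Fin 3)) (2 * ρ)).indicator (fun _ => ∫ z, g z) x +
        32 * L1 * lamKTrunc ρ x := by
      refine add_nonneg ?_ (by have := lamKTrunc_nonneg ρ x; positivity)
      by_cases hx : x ∈ ball (0 : EuclideanSpace ℝ (Fin 3)) (2 * ρ)
      · rw [indicator_of_mem hx]; exact hIg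
      · rw [indicator_of_notMem hx]
    exact mul_le_mul hfx (mul_le_mul_of_nonneg_left hLn (by norm_num)) (by positivity) (by positivity)
  · -- pointwise limit
    have h := tendsto_secondDiffOp_real hac ha0 ha2 x
    have h2 : Tendsto (fun n : ℕ => (1 / 2 : ℝ) *
        ∫ z, lamKTrunc (1 / ((n : ℝ) + 1)) z * (2 * a x - a (x + z) - a (x - z))) atTop
        (𝓝 (fracLapHalfS a x)) := by
      unfold fracLapHalfS
      exact h.const_mul _
    exact h2.const_mul _

/-! ### The identity -/

/-- **The Gagliardo–`Λ` identity** `gagliardo a f = ∫ a⟪f, Λ f⟫ − ½ ∫ ‖f‖² Λ a`, for a non-negative continuous weight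
with quadratic second differences supported in `B_ρ(0)` and a bounded Lipschitz continuous field with quadratic second
differences (all Bochner integrals involved are genuine). -/
theorem gagliardo_eq_integral_sub (hac : Continuous a) (hann : ∀ x, 0 ≤ a x) (ha0 : ∀ x, |a x| ≤ A₀)
    (ha2 : ∀ x z, |2 * a x - a (x + z) - a (x - z)| ≤ A₂ * ‖z‖ ^ 2) (hρ : 0 < ρ)
    (hsupp : ∀ x, ρ ≤ ‖x‖ → a x = 0)
    (hfc : Continuous f) (hf0 : ∀ x, ‖f x‖ ≤ M₀) (hf1 : ∀ x y, ‖f x - f y‖ ≤ M₁ * ‖x - y‖)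
    (hf2 : ∀ x z, ‖(2 : ℝ) • f x - f (x + z) - f (x - z)‖ ≤ M₂ * ‖z‖ ^ 2) :
    gagliardo a f = (∫ x, a x * ⟪f x, fracLapHalf f x⟫) - (1 / 2 : ℝ) * ∫ x, ‖f x‖ ^ 2 * fracLapHalfS a x := by
  -- the weight is integrable (continuous, compact support)
  have hcs : HasCompactSupport a := by
    refine HasCompactSupport.intro (isCompact_closedBall (0 : EuclideanSpace ℝ (Fin 3)) ρ) fun x hx => ?_
    exact hsupp x (le_of_lt (by simpa [mem_closedBall, dist_zero_right] using hx))
  have hai : Integrable a := hac.integrable_of_hasCompactSupport hcs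
  -- the truncated identities
  have hid : ∀ n : ℕ,
      (∫ x, a x * ⟪f x, (1 / 2 : ℝ) • ∫ z, lamKTrunc (1 / ((n : ℝ) + 1)) z • ((2 : ℝ) • f x - f (x + z) - f (x - z))⟫) =
        (1 / 4 : ℝ) * (∫ p : EuclideanSpace ℝ (Fin 3) × EuclideanSpace ℝ (Fin 3),
            symG a f (lamKTrunc (1 / ((n : ℝ) + 1))) p) +
          (1 / 2 : ℝ) * ∫ x, ‖f x‖ ^ 2 *
            ((1 / 2 : ℝ) * ∫ z, lamKTrunc (1 / ((n : ℝ) + 1)) z * (2 * a x - a (x + z) - a (x - z))) :=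
    fun n => truncated_symmetrisation hac.measurable hai ha0 hfc hf0 (by positivity)
  -- the three limits
  have hI := tendsto_helicitySide hac hai hfc hf0 hf2
  have hG := tendsto_integral_symG hac hai hann hfc hf0 hf1
  have hJ := tendsto_weightSide (f := f) hac hai ha0 ha2 hρ hsupp hfc hf0
  have hsum : Tendsto (fun n : ℕ =>
      (1 / 4 : ℝ) * (∫ p : EuclideanSpace ℝ (Fin 3) × EuclideanSpace ℝ (Fin 3),
          symG a f (lamKTrunc (1 / ((n : ℝ) + 1))) p) +
        (1 / 2 : ℝ) * ∫ x, ‖f x‖ ^ 2 *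
          ((1 / 2 : ℝ) * ∫ z, lamKTrunc (1 / ((n : ℝ) + 1)) z * (2 * a x - a (x + z) - a (x - z))))
      atTop (𝓝 ((1 / 4 : ℝ) * (∫ p : EuclideanSpace ℝ (Fin 3) × EuclideanSpace ℝ (Fin 3), symG a f lamK p) +
        (1 / 2 : ℝ) * ∫ x, ‖f x‖ ^ 2 * fracLapHalfS a x)) :=
    (hG.const_mul _).add (hJ.const_mul _)
  have hlim := tendsto_nhds_unique (hI.congr hid) hsum
  rw [gagliardo_eq_integral_symG, hlim]
  ring

/-- **The B1′ shape with no truncation left**: `gagliardo a f ≤ ∫ a⟪f, Λ f⟫ + ½ ∫ ‖f‖² |Λ a|`. -/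
theorem gagliardo_le_integral_add (hac : Continuous a) (hann : ∀ x, 0 ≤ a x) (ha0 : ∀ x, |a x| ≤ A₀)
    (ha2 : ∀ x z, |2 * a x - a (x + z) - a (x - z)| ≤ A₂ * ‖z‖ ^ 2) (hρ : 0 < ρ)
    (hsupp : ∀ x, ρ ≤ ‖x‖ → a x = 0)
    (hfc : Continuous f) (hf0 : ∀ x, ‖f x‖ ≤ M₀) (hf1 : ∀ x y, ‖f x - f y‖ ≤ M₁ * ‖x - y‖)
    (hf2 : ∀ x z, ‖(2 : ℝ) • f x - f (x + z) - f (x - z)‖ ≤ M₂ * ‖z‖ ^ 2) :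
    gagliardo a f ≤ (∫ x, a x * ⟪f x, fracLapHalf f x⟫) + (1 / 2 : ℝ) * ∫ x, ‖f x‖ ^ 2 * |fracLapHalfS a x| := by
  rw [gagliardo_eq_integral_sub hac hann ha0 ha2 hρ hsupp hfc hf0 hf1 hf2]
  have h1 : -(∫ x, ‖f x‖ ^ 2 * fracLapHalfS a x) ≤ |∫ x, ‖f x‖ ^ 2 * fracLapHalfS a x| := neg_le_abs _
  have h2 : |∫ x, ‖f x‖ ^ 2 * fracLapHalfS a x| ≤ ∫ x, |‖f x‖ ^ 2 * fracLapHalfS a x| := abs_integral_le_integral_abs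
  have h3 : ∫ x, |‖f x‖ ^ 2 * fracLapHalfS a x| = ∫ x, ‖f x‖ ^ 2 * |fracLapHalfS a x| :=
    integral_congr_ae (Eventually.of_forall fun x => by
      show |‖f x‖ ^ 2 * fracLapHalfS a x| = ‖f x‖ ^ 2 * |fracLapHalfS a x|
      rw [abs_mul, abs_of_nonneg (by positivity : (0 : ℝ) ≤ ‖f x‖ ^ 2)])
  linarith

end Main

end Summit.NavierStokesRegularity.NavierStokesRegularity.Theorems.ChiralWindowDoorGagliardoIdentity
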